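import Summits.CriticalPhenomena.PercolationContinuityZ3.Theorems.PercNearOneGluingNoHeavyRsw3VolumeMomentSums
import HarnessLib

/-!
# The volume of Kesten's IIC has an exponential upper tail, I: ORDERED weights of a tuple and their lattice sum `≤ t!·Θ(n)^t` (lane RSW3, p1 gen 28)

builds on p205010 (kernel theorem, internal audit signed; external expert review pending) — NOT used in this file (every `p`;
deterministic / one-arm ratio inequality (R_lin) only).

RSW3 lane (LANE 3 `prim-rsw3`), seat `prim-rsw3-p1` (gen 28).  Helper file (`--supports stmt-CriticalPhenomena-4575`); no definitions,
no sorries.  Memo `run/shared/lean/prim/rsw3/P1-QM.md` §41.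

Kesten's Theorem (8) (p2 gen 21 `…Rsw3IICVolumeMoments`, every fixed moment) bounds `E_ν V_n^t ≤ C_t (n^d π(n))^t` with an untracked `C_t`
(the nearest-NEIGHBOUR weight `W(S) = ∏_{x ∈ S} π(⌊(δ⟦S,x⟧−1)/2⌋)` changes in up to `t` factors when a point is inserted, which costs
`(B/π(1))^{t}` per step).  Gen 28 uses instead the ORDERED weight of a tuple `q : Fin t → ℤ^d`,
`W→(q) = ∏_{a} π(D_a(q))`, `D_a(q) = dist_∞(q_a, {0} ∪ {q_b : b > a})` (the distance to the LATER points and the root) — the weight that the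
nearest-parent tree bound of p1 gen 22 (`…IICSpanningTree`) produces for EVERY insertion order.  Inserting a new FIRST point `x` in front
of `q` leaves every factor of `q` unchanged and costs `π(D_0) ≤ Σ_{w ∈ {0} ∪ range q} π(‖x − w‖)`, whose lattice sum over `x ∈ Λ(n)` is at most
`(t+1)·Θ(n)`, `Θ(n) = Σ_{z ∈ Λ(2n)} π(‖z‖)`.  Hence, with NO tree counting:

* `image_filter_lt_zero_cons`, `image_filter_lt_succ_cons`, `prod_orderedWeight_cons` — `W→(cons x q) = π(D_0(cons x q)) · W→(q)`;
* `apply_inf_toNat_le_sum` — `f(D) ≤ Σ_{w ∈ L} f(‖x − w‖)` for the attained infimum `D` over a nonempty finite `L` (`f ≥ 0`);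
* `sum_box_head_weight_le` — `Σ_{x ∈ Λ(n)} π(D_0(cons x q)) ≤ (t+1) · Θ(n)` for `q : Fin t → Λ(n)`;
* **`sum_piFinset_orderedWeight_le_factorial_mul_pow`** — **`Σ_{q : Fin t → Λ(n)} W→(q) ≤ t! · Θ(n)^t`** (every `p`, `d`, `n`, `t`);
* `sum_box_two_mul_oneArmProb_le` — under (R_lin) and `π(1) > 0`: `Θ(n) ≤ 2^d C₁ · n^d π(n)` (`C₁` of p2's `sum_oneArmProb_le_of_linRatio`);
* **`sum_piFinset_orderedWeight_le_factorial_mul_pow_volumeScale`** — **`Σ_q W→(q) ≤ t! · (2^d C₁ n^d π(n))^t`**, `n ≥ 1`.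
Parts II–III (`…IICVolumeTailReduction`, `…IICVolumeExponentialTail`): `ν(⋂_a {0 ↔ q_a}) ≤ C^t W→(q)` for EVERY tuple, hence
`E_ν V_n^t ≤ t! (C' n^d π(n))^t` and `ν(V_n ≥ λ n^d π(n)) ≤ 2e^{−cλ}`.
References: H. Kesten, Probab. Theory Relat. Fields 73 (1986) 369–394, Thm. (8), (46)–(53) [Kesten1986]; M. Aizenman, C. M. Newman,
J. Stat. Phys. 36 (1984) 107–143 (tree-graph bounds); C. Borgs, J. Chayes, H. Kesten, J. Spencer, Comm. Math. Phys. 224 (2001) 153–204, §3.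
-/

noncomputable section

namespace Summit.CriticalPhenomena.PercolationContinuityZ3.Theorems.Crossing

open MeasureTheory Literature.Probability.Percolation Literature.Probability.LatticeModels
open Literature.Probability.Percolation.DCT16
open Summit.CriticalPhenomena.PercolationContinuityZ3.Theorems.SurfaceTension
open Summit.CriticalPhenomena.PercolationContinuityZ3.Theorems.Rsw3

variable {d : ℕ}

/-! ## §1 The ordered weight splits off its first point -/

/-- The later points of the head of `cons x q` are all the points of `q`. [folklore] -/
theorem image_filter_lt_zero_cons {α : Type*} [DecidableEq α] {t : ℕ} (x : α) (q : Fin t → α) :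
    (Finset.univ.filter fun b : Fin (t + 1) => (0 : Fin (t + 1)) < b).image (Fin.cons x q : Fin (t + 1) → α) =
      Finset.univ.image q := by
  ext z
  simp only [Finset.mem_image, Finset.mem_filter, Finset.mem_univ, true_and]
  constructor
  · rintro ⟨b, hb, rfl⟩
    obtain ⟨b', rfl⟩ := Fin.eq_succ_of_ne_zero (ne_of_gt hb)
    exact ⟨b', by rw [Fin.cons_succ]⟩
  · rintro ⟨b', rfl⟩
    exact ⟨b'.succ, Fin.succ_pos b', by rw [Fin.cons_succ]⟩

/-- The later points of the `(a+1)`-st entry of `cons x q` are the later points of the `a`-th entry of `q`. [folklore] -/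
theorem image_filter_lt_succ_cons {α : Type*} [DecidableEq α] {t : ℕ} (x : α) (q : Fin t → α) (a : Fin t) :
    (Finset.univ.filter fun b : Fin (t + 1) => a.succ < b).image (Fin.cons x q : Fin (t + 1) → α) =
      (Finset.univ.filter fun b : Fin t => a < b).image q := by
  ext z
  simp only [Finset.mem_image, Finset.mem_filter, Finset.mem_univ, true_and]
  constructor
  · rintro ⟨b, hb, rfl⟩
    have hb0 : b ≠ 0 := by
      rintro rfl
      exact absurd hb (not_lt.2 (Fin.zero_le _))
    obtain ⟨b', rfl⟩ := Fin.eq_succ_of_ne_zero hb0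
    exact ⟨b', Fin.succ_lt_succ_iff.1 hb, by rw [Fin.cons_succ]⟩
  · rintro ⟨b', hb', rfl⟩
    exact ⟨b'.succ, Fin.succ_lt_succ_iff.2 hb', by rw [Fin.cons_succ]⟩

/-- **The ordered weight splits off its first point**: for any `f : ℕ → ℝ`,
`∏_{a : Fin (t+1)} f(D_a(cons x q)) = f(D_0(cons x q)) · ∏_{a : Fin t} f(D_a(q))`, where
`D_a(q) = dist_∞(q_a, {0} ∪ {q_b : b > a})` (as `(inf …).toNat`): the later points of an old entry are unchanged. [folklore] -/
theorem prod_orderedWeight_cons {t : ℕ} (f : ℕ → ℝ) (x : Site d) (q : Fin t → Site d) :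
    ∏ a : Fin (t + 1), f (((insert (0 : Site d)
        ((Finset.univ.filter fun b : Fin (t + 1) => a < b).image (Fin.cons x q : Fin (t + 1) → Site d))).inf
          (fun w => ((Site.supNorm ((Fin.cons x q : Fin (t + 1) → Site d) a - w) : ℕ) : ℕ∞))).toNat) =
      f (((insert (0 : Site d) (Finset.univ.image q)).inf (fun w => ((Site.supNorm (x - w) : ℕ) : ℕ∞))).toNat) *
        ∏ a : Fin t, f (((insert (0 : Site d) ((Finset.univ.filter fun b : Fin t => a < b).image q)).inf
          (fun w => ((Site.supNorm (q a - w) : ℕ) : ℕ∞))).toNat) := by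
  classical
  rw [Fin.prod_univ_succ]
  congr 1
  · rw [image_filter_lt_zero_cons, Fin.cons_zero]
  · refine Finset.prod_congr rfl fun a _ => ?_
    rw [image_filter_lt_succ_cons, Fin.cons_succ]

/-! ## §2 One more (first) point costs `(t+1)·Θ(n)` -/

/-- For a nonempty finite set of sites `L`, a site `x` and `f ≥ 0`: `f(D) ≤ Σ_{w ∈ L} f(‖x − w‖_∞)` where `D = min_{w ∈ L} ‖x − w‖_∞`
(the infimum is attained). [folklore] -/
theorem apply_inf_toNat_le_sum {L : Finset (Site d)} (hL : L.Nonempty) (x : Site d) {f : ℕ → ℝ} (hf : ∀ m, 0 ≤ f m) :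
    f ((L.inf (fun w => ((Site.supNorm (x - w) : ℕ) : ℕ∞))).toNat) ≤ ∑ w ∈ L, f (Site.supNorm (x - w)) := by
  obtain ⟨w₀, hw₀, heq⟩ := Finset.exists_mem_eq_inf L hL (fun w => ((Site.supNorm (x - w) : ℕ) : ℕ∞))
  rw [heq, ENat.toNat_coe]
  exact Finset.single_le_sum (fun w _ => hf (Site.supNorm (x - w))) hw₀

/-- **One more point**: for `q : Fin t → Λ(n)`,
`Σ_{x ∈ Λ(n)} π(D_0(cons x q)) ≤ (t+1) · Θ(n)`, `Θ(n) = Σ_{z ∈ Λ(2n)} π(‖z‖_∞)`: `π(D_0) ≤ Σ_{w ∈ {0} ∪ range q} π(‖x − w‖)`, each `w` lies in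
`Λ(n)`, `x − w ∈ Λ(2n)`, and `|{0} ∪ range q| ≤ t + 1`. [cite: Kesten1986, Thm. (8), (52)–(53)] -/
theorem sum_box_head_weight_le (p : unitInterval) {n t : ℕ} {q : Fin t → Site d}
    (hq : q ∈ Fintype.piFinset (fun _ : Fin t => box d n)) :
    ∑ x ∈ box d n, oneArmProb d p (((insert (0 : Site d) (Finset.univ.image q)).inf
        (fun w => ((Site.supNorm (x - w) : ℕ) : ℕ∞))).toNat) ≤
      ((t : ℝ) + 1) * ∑ z ∈ box d (2 * n), oneArmProb d p (Site.supNorm z) := by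
  classical
  set L : Finset (Site d) := insert (0 : Site d) (Finset.univ.image q) with hLdef
  have hLne : L.Nonempty := ⟨0, Finset.mem_insert_self _ _⟩
  have hLn : L ⊆ box d n := insert_image_subset_box hq
  have hLcard : (L.card : ℝ) ≤ (t : ℝ) + 1 := by exact_mod_cast card_insert_image_le q
  have hπ0 : ∀ m, 0 ≤ oneArmProb d p m := fun m => measureReal_nonneg
  have hΘ0 : 0 ≤ ∑ z ∈ box d (2 * n), oneArmProb d p (Site.supNorm z) := Finset.sum_nonneg fun z _ => hπ0 _
  calc ∑ x ∈ box d n, oneArmProb d p ((L.inf (fun w => ((Site.supNorm (x - w) : ℕ) : ℕ∞))).toNat)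
      ≤ ∑ x ∈ box d n, ∑ w ∈ L, oneArmProb d p (Site.supNorm (x - w)) :=
        Finset.sum_le_sum fun x _ => apply_inf_toNat_le_sum hLne x hπ0
    _ = ∑ w ∈ L, ∑ x ∈ box d n, oneArmProb d p (Site.supNorm (x - w)) := Finset.sum_comm
    _ ≤ ∑ w ∈ L, ∑ z ∈ box d (2 * n), oneArmProb d p (Site.supNorm z) :=
        Finset.sum_le_sum fun w hw =>
          sum_box_sub_le_sum_box_two_mul (hLn hw) (g := fun z => oneArmProb d p (Site.supNorm z)) fun z => hπ0 _
    _ = (L.card : ℝ) * ∑ z ∈ box d (2 * n), oneArmProb d p (Site.supNorm z) := by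
        rw [Finset.sum_const, nsmul_eq_mul]
    _ ≤ ((t : ℝ) + 1) * ∑ z ∈ box d (2 * n), oneArmProb d p (Site.supNorm z) :=
        mul_le_mul_of_nonneg_right hLcard hΘ0

/-! ## §3 The lattice sum of the ordered weights -/

/-- **THE LATTICE SUM OF THE ORDERED WEIGHTS** (every `p`, `d`, `n`, `t`): with `Θ(n) = Σ_{z ∈ Λ(2n)} π_p(‖z‖_∞)` and
`W→(q) = ∏_{a} π_p(D_a(q))`, `D_a(q) = dist_∞(q_a, {0} ∪ {q_b : b > a})`,
**`Σ_{q : Fin t → Λ(n)} W→(q) ≤ t! · Θ(n)^t`** — by induction on `t`, peeling the first point: its factor is the only one that sees it,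
and its lattice sum is `≤ (t+1)Θ(n)` (`sum_box_head_weight_le`).  The ordered analogue of Kesten's (46)–(47) with the factorial in place of
Kesten's untracked `C₂(t)`. [cite: Kesten1986, Thm. (8), (46)–(47), (52)] -/
theorem sum_piFinset_orderedWeight_le_factorial_mul_pow (p : unitInterval) (n t : ℕ) :
    ∑ q ∈ Fintype.piFinset (fun _ : Fin t => box d n),
        ∏ a : Fin t, oneArmProb d p (((insert (0 : Site d) ((Finset.univ.filter fun b : Fin t => a < b).image q)).inf
          (fun w => ((Site.supNorm (q a - w) : ℕ) : ℕ∞))).toNat) ≤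
      (t.factorial : ℝ) * (∑ z ∈ box d (2 * n), oneArmProb d p (Site.supNorm z)) ^ t := by
  classical
  set Θ : ℝ := ∑ z ∈ box d (2 * n), oneArmProb d p (Site.supNorm z) with hΘ
  have hπ0 : ∀ m, 0 ≤ oneArmProb d p m := fun m => measureReal_nonneg
  have hΘ0 : 0 ≤ Θ := Finset.sum_nonneg fun z _ => hπ0 _
  induction t with
  | zero =>
    rw [sum_piFinset_zero_const (box d n) (1 : ℝ) _ fun q => by rw [Finset.univ_eq_empty, Finset.prod_empty]]
    simp
  | succ t ih =>
    rw [sum_piFinset_succ_const]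
    have hstep : ∀ x ∈ box d n, ∑ q ∈ Fintype.piFinset (fun _ : Fin t => box d n),
        ∏ a : Fin (t + 1), oneArmProb d p (((insert (0 : Site d)
          ((Finset.univ.filter fun b : Fin (t + 1) => a < b).image (Fin.cons x q : Fin (t + 1) → Site d))).inf
            (fun w => ((Site.supNorm ((Fin.cons x q : Fin (t + 1) → Site d) a - w) : ℕ) : ℕ∞))).toNat) =
        ∑ q ∈ Fintype.piFinset (fun _ : Fin t => box d n),
          oneArmProb d p (((insert (0 : Site d) (Finset.univ.image q)).inf (fun w => ((Site.supNorm (x - w) : ℕ) : ℕ∞))).toNat) *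
            ∏ a : Fin t, oneArmProb d p (((insert (0 : Site d) ((Finset.univ.filter fun b : Fin t => a < b).image q)).inf
              (fun w => ((Site.supNorm (q a - w) : ℕ) : ℕ∞))).toNat) :=
      fun x _ => Finset.sum_congr rfl fun q _ => prod_orderedWeight_cons (oneArmProb d p) x q
    rw [Finset.sum_congr rfl hstep, Finset.sum_comm]
    -- now `Σ_q W(q) · Σ_x π(D_0(cons x q))`
    have hW0 : ∀ q : Fin t → Site d, 0 ≤ ∏ a : Fin t, oneArmProb d p (((insert (0 : Site d)
        ((Finset.univ.filter fun b : Fin t => a < b).image q)).inf (fun w => ((Site.supNorm (q a - w) : ℕ) : ℕ∞))).toNat) :=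
      fun q => Finset.prod_nonneg fun a _ => hπ0 _
    calc ∑ q ∈ Fintype.piFinset (fun _ : Fin t => box d n), ∑ x ∈ box d n,
          oneArmProb d p (((insert (0 : Site d) (Finset.univ.image q)).inf (fun w => ((Site.supNorm (x - w) : ℕ) : ℕ∞))).toNat) *
            ∏ a : Fin t, oneArmProb d p (((insert (0 : Site d) ((Finset.univ.filter fun b : Fin t => a < b).image q)).inf
              (fun w => ((Site.supNorm (q a - w) : ℕ) : ℕ∞))).toNat)
        = ∑ q ∈ Fintype.piFinset (fun _ : Fin t => box d n),
            (∑ x ∈ box d n, oneArmProb d p (((insert (0 : Site d) (Finset.univ.image q)).inf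
              (fun w => ((Site.supNorm (x - w) : ℕ) : ℕ∞))).toNat)) *
            ∏ a : Fin t, oneArmProb d p (((insert (0 : Site d) ((Finset.univ.filter fun b : Fin t => a < b).image q)).inf
              (fun w => ((Site.supNorm (q a - w) : ℕ) : ℕ∞))).toNat) := by
          refine Finset.sum_congr rfl fun q _ => ?_
          rw [Finset.sum_mul]
      _ ≤ ∑ q ∈ Fintype.piFinset (fun _ : Fin t => box d n), (((t : ℝ) + 1) * Θ) *
            ∏ a : Fin t, oneArmProb d p (((insert (0 : Site d) ((Finset.univ.filter fun b : Fin t => a < b).image q)).inf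
              (fun w => ((Site.supNorm (q a - w) : ℕ) : ℕ∞))).toNat) :=
          Finset.sum_le_sum fun q hq => mul_le_mul_of_nonneg_right (sum_box_head_weight_le p hq) (hW0 q)
      _ = (((t : ℝ) + 1) * Θ) * ∑ q ∈ Fintype.piFinset (fun _ : Fin t => box d n),
            ∏ a : Fin t, oneArmProb d p (((insert (0 : Site d) ((Finset.univ.filter fun b : Fin t => a < b).image q)).inf
              (fun w => ((Site.supNorm (q a - w) : ℕ) : ℕ∞))).toNat) := (Finset.mul_sum _ _ _).symm
      _ ≤ (((t : ℝ) + 1) * Θ) * ((t.factorial : ℝ) * Θ ^ t) :=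
          mul_le_mul_of_nonneg_left ih (mul_nonneg (by positivity) hΘ0)
      _ = ((t + 1).factorial : ℝ) * Θ ^ (t + 1) := by
          rw [Nat.factorial_succ]; push_cast; ring

/-! ## §4 The scale: `Θ(n) ≤ 2^d C₁ · n^d π(n)` under (R_lin) -/

/-- **`Θ(n) = Σ_{z ∈ Λ(2n)} π_p(‖z‖_∞) ≤ 2^d C₁ · n^d π_p(n)`** for `n ≥ 1` (every `p` with (R_lin) `π(j)(j/(4m))^{d−1} ≤ A π(m)`, `1 ≤ j ≤ m`,
and `π(1) > 0`; `d ≥ 1`): `π(‖z‖) ≤ π(⌊(‖z‖−1)/2⌋)`, p2's `sum_oneArmProb_le_of_linRatio` on `Λ(2n)`, and `π(2n) ≤ π(n)`;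
`C₁ = 2dA·48^{d−1} + 5^d A 4^{d−1}/π(1)`. [cite: Kesten1986, Thm. (8), (53)] -/
theorem sum_box_two_mul_oneArmProb_le (hd : 1 ≤ d) (p : unitInterval) {A : ℝ} (hA : 0 ≤ A)
    (hR : ∀ j n : ℕ, 1 ≤ j → j ≤ n →
      oneArmProb d p j * ((j : ℝ) / (4 * n)) ^ (d - 1) ≤ A * oneArmProb d p n)
    (hπ1 : 0 < oneArmProb d p 1) {n : ℕ} (hn : 1 ≤ n) :
    ∑ z ∈ box d (2 * n), oneArmProb d p (Site.supNorm z) ≤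
      (2 : ℝ) ^ d * (2 * d * A * (48 : ℝ) ^ (d - 1) + (5 : ℝ) ^ d * (A * (4 : ℝ) ^ (d - 1) / oneArmProb d p 1)) *
        ((n : ℝ) ^ d * oneArmProb d p n) := by
  have h2n : 1 ≤ 2 * n := by omega
  have h1 : ∑ z ∈ box d (2 * n), oneArmProb d p (Site.supNorm z) ≤
      ∑ z ∈ box d (2 * n), oneArmProb d p ((Site.supNorm z - 1) / 2) :=
    Finset.sum_le_sum fun z _ => real_siteToBoundary_antitone p (by omega)
  have h2 := sum_oneArmProb_le_of_linRatio hd p hA hR hπ1 h2n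
  have hπ2n : oneArmProb d p (2 * n) ≤ oneArmProb d p n := real_siteToBoundary_antitone p (by omega)
  have hC0 : 0 ≤ 2 * d * A * (48 : ℝ) ^ (d - 1) + (5 : ℝ) ^ d * (A * (4 : ℝ) ^ (d - 1) / oneArmProb d p 1) := by
    have hd0 : (0 : ℝ) ≤ d := Nat.cast_nonneg d
    positivity
  have hcast : ((2 * n : ℕ) : ℝ) ^ d = (2 : ℝ) ^ d * (n : ℝ) ^ d := by push_cast; rw [mul_pow]
  calc ∑ z ∈ box d (2 * n), oneArmProb d p (Site.supNorm z)
      ≤ (2 * d * A * (48 : ℝ) ^ (d - 1) + (5 : ℝ) ^ d * (A * (4 : ℝ) ^ (d - 1) / oneArmProb d p 1)) *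
          ((2 * n : ℕ) : ℝ) ^ d * oneArmProb d p (2 * n) := h1.trans h2
    _ ≤ (2 * d * A * (48 : ℝ) ^ (d - 1) + (5 : ℝ) ^ d * (A * (4 : ℝ) ^ (d - 1) / oneArmProb d p 1)) *
          ((2 * n : ℕ) : ℝ) ^ d * oneArmProb d p n :=
        mul_le_mul_of_nonneg_left hπ2n (mul_nonneg hC0 (by positivity))
    _ = _ := by rw [hcast]; ring

/-- **THE LATTICE SUM OF THE ORDERED WEIGHTS AT THE VOLUME SCALE** (every `p` with (R_lin) and `π(1) > 0`; `d ≥ 1`; `n ≥ 1`):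
**`Σ_{q : Fin t → Λ(n)} W→(q) ≤ t! · (K · n^d π_p(n))^t`**, `K = 2^d C₁` — the summation half of `E_ν V_n^t ≤ t!·(C n^d π(n))^t`.
[cite: Kesten1986, Thm. (8), (46)–(47)] -/
theorem sum_piFinset_orderedWeight_le_factorial_mul_pow_volumeScale (hd : 1 ≤ d) (p : unitInterval) {A : ℝ} (hA : 0 ≤ A)
    (hR : ∀ j n : ℕ, 1 ≤ j → j ≤ n →
      oneArmProb d p j * ((j : ℝ) / (4 * n)) ^ (d - 1) ≤ A * oneArmProb d p n)
    (hπ1 : 0 < oneArmProb d p 1) {n : ℕ} (hn : 1 ≤ n) (t : ℕ) :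
    ∑ q ∈ Fintype.piFinset (fun _ : Fin t => box d n),
        ∏ a : Fin t, oneArmProb d p (((insert (0 : Site d) ((Finset.univ.filter fun b : Fin t => a < b).image q)).inf
          (fun w => ((Site.supNorm (q a - w) : ℕ) : ℕ∞))).toNat) ≤
      (t.factorial : ℝ) * ((2 : ℝ) ^ d * (2 * d * A * (48 : ℝ) ^ (d - 1) + (5 : ℝ) ^ d * (A * (4 : ℝ) ^ (d - 1) / oneArmProb d p 1)) *
        ((n : ℝ) ^ d * oneArmProb d p n)) ^ t := by
  have hΘ0 : 0 ≤ ∑ z ∈ box d (2 * n), oneArmProb d p (Site.supNorm z) := Finset.sum_nonneg fun z _ => measureReal_nonneg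
  refine (sum_piFinset_orderedWeight_le_factorial_mul_pow p n t).trans ?_
  exact mul_le_mul_of_nonneg_left (pow_le_pow_left₀ hΘ0 (sum_box_two_mul_oneArmProb_le hd p hA hR hπ1 hn) t) (by positivity)

end Summit.CriticalPhenomena.PercolationContinuityZ3.Theorems.Crossing

end
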